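import Summits.ResolutionOfSingularities.ResolutionOfSingularities.Theorems.HilbertSamuelEliminationSigmaMaxModificationsCorridor3WLadderSegmentsCentreNear
import Summits.ResolutionOfSingularities.ResolutionOfSingularities.Theorems.HilbertSamuelEliminationSigmaMaxModificationsCorridor3WLadderRecognitionNearLocusUnit
import Summits.ResolutionOfSingularities.ResolutionOfSingularities.Theorems.HilbertSamuelEliminationSigmaMaxModificationsCorridor3WLadderRecognitionNearLocusLocalize
import HarnessLib

/-!
# [OURS · L1 W4.2] CLAUSE (ii)′ OF CJS Def. 6.38 FOR THE REPAIRED UNIT TOWER — `C_1 = ℙ(Dir_x)` — from the near-locus geometry, the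
# printed locus form of Thm. 3.14 at a point, and a small topological fact about curves
# (crux `SigmaMaxModifications` stmt-ResolutionOfSingularities-18506; conjunct `SigmaMaxModificationsCorridor3` stmt-…-19249; line `w_ladder`; RECOGNITION)

Stub worker res-L1-w42-stub-1 (gen 4). Helper file `--supports stmt-ResolutionOfSingularities-19249 --as helper`; kernel only, no new definition.
Uses ONE printed named fact as a hypothesis: `Thm314_point_locus` (CJS Thm. 3.14, locus form at a point centre, binder `h314pt` of the
char row), through stub-2's `Helpers.BlowupTowerNear.nearLocus_one_subset_projDir` (p529880-lineage).

* `Seg.isIrreducible_preimage_of_isEmbedding` — irreducibility pulls back along an embedding onto a set in its range (topology).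
* `Seg.eq_of_isIrreducible_infinite_subset_curveLike` — in a sober `T₀` space, an INFINITE closed irreducible subset of an irreducible closed
  set `K` all of whose non-generic points are closed IS `K` (otherwise all its points are closed, and an irreducible set of closed points is its
  closed generic point — finite).
* **`Seg.unitTowerU_C_one_eq_projDir`** — for the repaired unit tower `unitTowerU b he` of a unit of length `≥ 2` at a blown-up isolated base
  `b` of a chain from a maximal origin, in the (F1) range at `x_b`: **`C_1 = ℙ(Dir_{𝔪_{x_b}})`**. Proof: `C_1 = N_1` (clause (iii),
  `…CentreNear`, from (Dich)/(RegN)); `N_1 ⊆ ℙ(Dir)` (Thm. 3.14 point locus, stub-2); `ℙ(Dir)` is an irreducible curve with closed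
  non-generic points (`curveData_projDir`, P-a discharged `ProjDir_projLine_holds`); `N_1` is infinite irreducible closed (the rank-1 stage
  of a unit of length `≥ 2` is not isolated; (Dich) there; transfer DOWN the localisation embedding). So the clause (ii)′ of
  `Seg.UnitGeometryAtQM` is discharged modulo `h314pt` and (F1) at the base — leaving (Dich)/(RegN), (iv), (v).

OURS bookkeeping; NOT a statement of the manuscript [Hironaka2017] nor of [CossartJannsenSaito2020]. AI-written; AI review is weaker than expert
review.

References: V. Cossart, U. Jannsen, S. Saito, LNM 2270 (2020), Thm. 3.14, Lemma 6.33, Def. 6.38 (ii), p. 103–105 [CossartJannsenSaito2020].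
-/

noncomputable section

set_option linter.dupNamespace false -- namespace `…Corridor3.Moving` re-enters `…Corridor3` (module convention of the Moving files)

open CategoryTheory AlgebraicGeometry TopologicalSpace Topology IsLocalRing
open Literature.AlgebraicGeometry.Resolution Literature.RingTheory.HilbertSamuel
open Literature.AlgebraicGeometry.CossartJannsenSaito2020
open Summit.ResolutionOfSingularities.ResolutionOfSingularities.Theorems.CampaignW42
open Summit.ResolutionOfSingularities.ResolutionOfSingularities.Theorems.SigmaMaxModificationsCorridor3.Helpers

namespace Summit.ResolutionOfSingularities.ResolutionOfSingularities.Theorems.SigmaMaxModificationsCorridor3.Moving.Seg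

/-! ## §1. Two topological facts -/

/-- **Irreducibility pulls back along an embedding onto a set inside its range.** [folklore] -/
theorem isIrreducible_preimage_of_isEmbedding {α β : Type*} [TopologicalSpace α] [TopologicalSpace β] {f : α → β}
    (hf : Topology.IsEmbedding f) {t : Set β} (ht : IsIrreducible t) (hsub : t ⊆ Set.range f) : IsIrreducible (f ⁻¹' t) := by
  refine ⟨?_, ?_⟩
  · obtain ⟨x, hx⟩ := ht.nonempty
    obtain ⟨a, rfl⟩ := hsub hx
    exact ⟨a, hx⟩
  · intro U V hU hV ⟨a, haT, haU⟩ ⟨a', ha'T, ha'V⟩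
    obtain ⟨U', hU', rfl⟩ := hf.isInducing.isOpen_iff.mp hU
    obtain ⟨V', hV', rfl⟩ := hf.isInducing.isOpen_iff.mp hV
    obtain ⟨z, hzT, hzU', hzV'⟩ := ht.isPreirreducible U' V' hU' hV' ⟨f a, haT, haU⟩ ⟨f a', ha'T, ha'V⟩
    obtain ⟨w, rfl⟩ := hsub hzT
    exact ⟨w, hzT, hzU', hzV'⟩

/-- **An INFINITE closed irreducible subset of an irreducible closed «curve-like» set `K` (all non-generic points of `K` are closed) IS `K`**
(sober `T₀` space): if it missed the generic point of `K`, all its points would be closed, and an irreducible set whose generic point is closed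
is a singleton. [folklore] -/
theorem eq_of_isIrreducible_infinite_subset_curveLike {α : Type*} [TopologicalSpace α] [QuasiSober α] [T0Space α] {K Z : Set α}
    (hK : IsIrreducible K) (hKcl : IsClosed K) (hpts : ∀ y ∈ K, ¬ IsGenericPoint y K → IsClosed ({y} : Set α))
    (hZ : IsIrreducible Z) (hZcl : IsClosed Z) (hZinf : Z.Infinite) (hZK : Z ⊆ K) : Z = K := by
  have hηK : IsGenericPoint hK.genericPoint K := hK.isGenericPoint_genericPoint hKcl
  by_cases hη : hK.genericPoint ∈ Z
  · refine Set.Subset.antisymm hZK ?_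
    rw [← hηK.def]
    exact closure_minimal (Set.singleton_subset_iff.mpr hη) hZcl
  · exfalso
    -- every point of `Z` is closed
    have hcl : ∀ z ∈ Z, IsClosed ({z} : Set α) := fun z hz =>
      hpts z (hZK hz) fun hgen => hη (hgen.eq hηK ▸ hz)
    -- the generic point of `Z` is closed, so `Z` is a singleton
    have hζ : IsGenericPoint hZ.genericPoint Z := hZ.isGenericPoint_genericPoint hZcl
    have hZeq : Z = {hZ.genericPoint} := hζ.def.symm.trans (hcl _ hζ.mem).closure_eq
    exact hZinf (hZeq ▸ Set.finite_singleton _)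

/-! ## §2. Clause (ii)′ for the repaired unit tower -/

section Unit

variable {R : ∀ S : Scheme.{0}, CentreSeq S → Prop} {N : ℕ} {ν : ℕ → ℕ} {k : Type} [Field k]
  {c : ℕ → MarkedStage.{0}} (hc : ∀ n, CanonicalNearStep R N ν (c n) (c (n + 1))) (hRf : OracleFunctional R) (hRa : OracleAdmissible R)
  (hν : ν ≠ iterPSum N Phi) (h0 : Helpers.CycleInv k N ν (c 0)) (hgen : ∀ n, ∃ m, n ≤ m ∧ (c m).IsBlownUp R N ν)
  (hBG : ∀ n, ∃ m, n ≤ m ∧ (c m).IsBlownUp R N ν ∧ Iso N (c m))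
  {p : ℕ} {X : Scheme.{0}} [IsLocallyNoetherian X] {x : X} (hX : IsMaximalOrigin p N ν X x)
  (hreach : Reaches R N ν (MarkedStage.init X x) (c 0))

include hX hreach in
/-- **At an interior blown-up stage of the unit the near locus is an infinite irreducible set** (the marked point is not isolated there, so the
finite branch of (Dich) is excluded: a finite near locus of closed points makes the marked point isolated in its stratum, hence `Iso`).
[cite: CossartJannsenSaito2020, Def. 6.38, Def. 13.3] -/
theorem infinite_irreducible_nearLocus_of_not_iso (b : ℕ)
    (hU : ∃ U : Set (c b).W, IsOpen U ∧ (c b).pt ∈ U ∧ U ∩ Scheme.hsStratum (c b).W N ν ⊆ {(c b).pt}) (n : ℕ) (hnG : ¬ Iso N (c (b + n)))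
    (hD : (((upTower hc hRa hν h0 b).nearLocus N (c b).pt n).Infinite ∧ IsIrreducible ((upTower hc hRa hν h0 b).nearLocus N (c b).pt n)) ∨
      (((upTower hc hRa hν h0 b).nearLocus N (c b).pt n).Finite ∧
        ∀ y ∈ (upTower hc hRa hν h0 b).nearLocus N (c b).pt n, IsClosed ({y} : Set (c (b + n)).W))) :
    ((upTower hc hRa hν h0 b).nearLocus N (c b).pt n).Infinite ∧ IsIrreducible ((upTower hc hRa hν h0 b).nearLocus N (c b).pt n) := by
  rcases hD with h | ⟨hfin, hcl⟩
  · exact h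
  · exfalso
    obtain ⟨O, hOo, hOY⟩ := exists_isOpen_inter_hsStratum_eq_singleton hc hRa hν h0 hX hreach b hU n hfin hcl (pt_mem_nearLocus hc hRa hν h0 hX hreach b n)
    refine hnG (iso_of_stratumIsolated (cycleInv_at hc hRa hν h0 (b + n))
      (pt_mem_hsStratum_of_reaches hX.mem_stratum (reaches_chain hreach hc (b + n))) ⟨O, hOo, ?_, hOY.le⟩)
    have : (c (b + n)).pt ∈ O ∩ Scheme.hsStratum (c (b + n)).W N ν := hOY ▸ Set.mem_singleton _
    exact this.1

include hRf hX hreach in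
/-- **CLAUSE (ii)′ OF Def. 6.38 FOR THE REPAIRED UNIT TOWER: `C_1 = ℙ(Dir_{𝔪_{x_b}})`** for a unit of length `≥ 2` at a blown-up isolated base,
in the (F1) range at `x_b`, modulo the printed point-locus form of Thm. 3.14 (`h314pt`), given (Dich)/(RegN) inside the unit.
[cite: CossartJannsenSaito2020, Def. 6.38 (ii), Thm. 3.14, Lemma 6.33] -/
theorem unitTowerU_C_one_eq_projDir (h314pt : Thm314_point_locus.{0}) (b : ℕ) (hb : (c b).IsBlownUp R N ν) (hiso : Iso N (c b))
    (hchar : CharHypothesis (c b).W (c b).pt) (h22 : ∀ n, Iso N (c n) → dirDim (c n) = 2 ∧ (c n).geomDirDim = 2)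
    (hDich : ∀ n, 0 < n → n < Seg.relIdxU hgen hBG b (Seg.relLen hgen hBG b) →
      (((upTower hc hRa hν h0 b).nearLocus N (c b).pt n).Infinite ∧ IsIrreducible ((upTower hc hRa hν h0 b).nearLocus N (c b).pt n)) ∨
      (((upTower hc hRa hν h0 b).nearLocus N (c b).pt n).Finite ∧
        ∀ y ∈ (upTower hc hRa hν h0 b).nearLocus N (c b).pt n, IsClosed ({y} : Set (c (b + n)).W)))
    (hReg : ∀ n, 0 < n → n < Seg.relIdxU hgen hBG b (Seg.relLen hgen hBG b) → ((upTower hc hRa hν h0 b).nearLocus N (c b).pt n).Infinite →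
      ∀ h : IsClosed ((upTower hc hRa hν h0 b).nearLocus N (c b).pt n),
        Scheme.IsRegular (Scheme.IdealSheafData.vanishingIdeal ⟨(upTower hc hRa hν h0 b).nearLocus N (c b).pt n, h⟩).subscheme)
    (hemp : HEmpU hc hRa hν h0 hgen hBG b) (h2 : 2 ≤ unitLen hgen hBG b) :
    (unitTowerU hc hRa hν h0 hgen hBG b hemp).C 1 = (unitTowerU hc hRa hν h0 hgen hBG b hemp).projDir (basePt hc hRa hν h0 b) := by
  haveI : IsLocallyNoetherian ((upTower hc hRa hν h0 b).X 0) := (upTower hc hRa hν h0 b).ln 0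
  haveI := flat_fromSpecStalk ((upTower hc hRa hν h0 b).X 0) ((c b).pt : (upTower hc hRa hν h0 b).X 0)
  obtain ⟨k', _, _, hg⟩ := hX.exists_stateGood_of_reaches hRa hν (reaches_chain hreach hc b)
  have hU := stratumIsolated_of_iso hg hiso
  -- (iii) at rank 1
  have hC1 : (unitTowerU hc hRa hν h0 hgen hBG b hemp).C 1 = (unitTowerU hc hRa hν h0 hgen hBG b hemp).nearLocus N (basePt hc hRa hν h0 b) 1 :=
    unitTowerU_C_eq_nearLocus hc hRf hRa hν h0 hgen hBG hX hreach b hb hiso hDich hReg hemp (Nat.lt_of_succ_le h2)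
  -- `N_1 ⊆ ℙ(Dir)` (Thm. 3.14, point locus) and the curve data of `ℙ(Dir)`
  have hC0 : (unitTowerU hc hRa hν h0 hgen hBG b hemp).C 0 = {basePt hc hRa hν h0 b} :=
    unitTowerU_C_zero hc hRa hν h0 hgen hBG hRf hX b hemp (reaches_chain hreach hc b) hb hU
  have hsub : (unitTowerU hc hRa hν h0 hgen hBG b hemp).nearLocus N (basePt hc hRa hν h0 b) 1 ⊆
      (unitTowerU hc hRa hν h0 hgen hBG b hemp).projDir (basePt hc hRa hν h0 b) :=
    BlowupTowerNear.nearLocus_one_subset_projDir (T := unitTowerU hc hRa hν h0 hgen hBG b hemp) h314pt (keySetting_unitTowerU hc hRa hν h0 hgen hBG b hemp)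
      (isPermissible_centreIdeal_unitTowerU hc hRa hν h0 hgen hBG b hemp) (isClosed_basePtU hc hRa hν h0 hgen hBG b hemp) hC0
      (charHypothesis_unitTowerU hc hRa hν h0 hgen hBG b hemp hchar)
  have he : (unitTowerU hc hRa hν h0 hgen hBG b hemp).dirDimAt 0 (basePt hc hRa hν h0 b) = 2 := (dirDimAt_unitTowerU_zero hc hRa hν h0 hgen hBG b hemp).trans (h22 b hiso).1
  obtain ⟨hKcl, hKirr, -, hKpts⟩ := BlowupTowerNear.curveData_projDir (T := unitTowerU hc hRa hν h0 hgen hBG b hemp) ProjDir_projLine_holds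
    (isClosed_basePtU hc hRa hν h0 hgen hBG b hemp) hC0 he
  -- `N_1` of the unit tower is the localised near locus of the chain at the first kept index `g_1`
  have h1lt : Seg.relIdxU hgen hBG b 1 < Seg.relIdxU hgen hBG b (Seg.relLen hgen hBG b) :=
    BlowupTower.cidx_strictMono 0 _ (Nat.lt_of_succ_le h2)
  have h1pos : 0 < Seg.relIdxU hgen hBG b 1 := BlowupTower.cidx_strictMono 0 _ Nat.one_pos
  have hN : (unitTowerU hc hRa hν h0 hgen hBG b hemp).nearLocus N (basePt hc hRa hν h0 b) 1 =
      (locι hc hRa hν h0 b (Seg.relIdxU hgen hBG b 1)).base ⁻¹' (upTower hc hRa hν h0 b).nearLocus N (c b).pt (Seg.relIdxU hgen hBG b 1) := by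
    have h1 := (locTower hc hRa hν h0 b).nearLocus_compress_zero (htriv_of_hEmpU hc hRa hν h0 hgen hBG hemp) N (basePt hc hRa hν h0 b) 1
    have h2' := (upTower hc hRa hν h0 b).nearLocus_baseChange
      (((upTower hc hRa hν h0 b).X 0).fromSpecStalk ((c b).pt : (upTower hc hRa hν h0 b).X 0)) N (basePt hc hRa hν h0 b) (Seg.relIdxU hgen hBG b 1)
    rw [show (((upTower hc hRa hν h0 b).X 0).fromSpecStalk ((c b).pt : (upTower hc hRa hν h0 b).X 0)).base (basePt hc hRa hν h0 b) = (c b).pt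
      from Scheme.fromSpecStalk_closedPoint] at h2'
    exact h1.trans h2'
  -- the chain's near locus at `g_1` is infinite irreducible (the stage is not `Iso`: rank `1 < unitLen`)
  have hnotG : ¬ Iso N (c (b + Seg.relIdxU hgen hBG b 1)) := by
    rw [Seg.relIdxU_eq_of_le hgen hBG b (Nat.le_of_succ_le h2)]
    exact Seg.not_G_add_relIdx_of_lt_relLen hgen hBG b le_rfl (Nat.lt_of_succ_le h2)
  obtain ⟨hinf, hirr⟩ := infinite_irreducible_nearLocus_of_not_iso hc hRa hν h0 hX hreach b hU _ hnotG (hDich _ h1pos h1lt)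
  -- transfer down the localisation embedding
  have hrange : (upTower hc hRa hν h0 b).nearLocus N (c b).pt (Seg.relIdxU hgen hBG b 1) ⊆
      Set.range (locι hc hRa hν h0 b (Seg.relIdxU hgen hBG b 1)).base := by
    have h := BlowupTowerNear.nearLocus_subset_range_bcι (upTower hc hRa hν h0 b)
      (((upTower hc hRa hν h0 b).X 0).fromSpecStalk ((c b).pt : (upTower hc hRa hν h0 b).X 0)) N (basePt hc hRa hν h0 b) (Seg.relIdxU hgen hBG b 1)
    rw [show (((upTower hc hRa hν h0 b).X 0).fromSpecStalk ((c b).pt : (upTower hc hRa hν h0 b).X 0)).base (basePt hc hRa hν h0 b) = (c b).pt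
      from Scheme.fromSpecStalk_closedPoint] at h
    exact h
  have hemb : Topology.IsEmbedding (locι hc hRa hν h0 b (Seg.relIdxU hgen hBG b 1)).base :=
    @Scheme.Hom.isEmbedding _ _ (locι hc hRa hν h0 b (Seg.relIdxU hgen hBG b 1))
      ((upTower hc hRa hν h0 b).isPreimmersion_bcι (((upTower hc hRa hν h0 b).X 0).fromSpecStalk ((c b).pt : (upTower hc hRa hν h0 b).X 0)) _)
  have hZirr : IsIrreducible ((unitTowerU hc hRa hν h0 hgen hBG b hemp).nearLocus N (basePt hc hRa hν h0 b) 1) := by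
    rw [hN]
    exact isIrreducible_preimage_of_isEmbedding hemb hirr hrange
  have hZinf : ((unitTowerU hc hRa hν h0 hgen hBG b hemp).nearLocus N (basePt hc hRa hν h0 b) 1).Infinite := by
    rw [hN]; exact hinf.preimage hrange
  have hZcl : IsClosed ((unitTowerU hc hRa hν h0 hgen hBG b hemp).nearLocus N (basePt hc hRa hν h0 b) 1) := by
    rw [hN]; exact (isClosed_nearLocus hc hRa hν h0 hX hreach b _).preimage (locι hc hRa hν h0 b _).continuous
  rw [hC1]
  exact eq_of_isIrreducible_infinite_subset_curveLike hKirr hKcl hKpts hZirr hZcl hZinf hsub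

end Unit

end Summit.ResolutionOfSingularities.ResolutionOfSingularities.Theorems.SigmaMaxModificationsCorridor3.Moving.Seg

end
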